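import Summits.AtomisticToContinuum.Crystallization.Theorems.DisclinationRationUniformPolytypeStabilityDefs

/-!
# `UniformPolytypeStability` (stmt-AtomisticToContinuum-15800), line `birth` (v2, cells): stub `stub_sites`

Route `DisclinationRation`, crux `UniformPolytypeStability` (uniform harmonic stability of Lennard-Jones layered
polytypes `L(a,s,z)` on the box `a ∈ [47/50, 1]`, gaps `h_m = z (m+1) − z m ∈ [39a/50, 17a/20]`), line `birth`
(lead prover-line-stmt-AtomisticToContinuum-15800-0).  This `--supports` file proves the registered stub

  `stub_sites : ∀ a s z, 47/50 ≤ a → a ≤ 1 → IsHaggSeq s → HeightBox a z → SitesFacts a s z`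

over the line vocabulary `…Theorems.DisclinationRationUniformPolytypeStabilityDefs` (`Idx`, `pos`, `Sites`,
`InPlaneNN`, `UpNN`, `UpDiag`, `NNPair`, `DiagPair`, `NearPair`, `SitesFacts`): the site map `pos a s z` is a
bijection `ℤ³ → Sites a s z`, distinct sites are `9/10`-separated, and the metric shells `dist ≤ 11/10`
(12 nearest neighbours) and `dist ≤ 29/20` (those plus the 6 octahedron diagonals) are exactly the combinatorial
shells `NNPair s`, `NearPair s`.  Elementary coordinates and two integer binary quadratic forms; sources: the
Barlow-stacking coordinates of `Literature/MathematicalPhysics/StatisticalMechanics/BarlowStacking.lean`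
(Hales 2012 §1.3 conventions), everything else folklore.  Nothing here closes an item; no new definitions.
-/

namespace Summit.AtomisticToContinuum.Crystallization.Theorems.UniformPolytypeStabilityCells

open Literature.MathematicalPhysics.StatisticalMechanics

/-! ## Stub `stub_sites`: the index picture of `Sites a s z` on the box

`pos a s z : Idx → ℝ³` is a bijection onto `Sites a s z`, distinct sites are `9/10`-separated, and the
two metric shells of the crux (`dist ≤ 11/10`, `dist ≤ 29/20`) coincide with the combinatorial shells
`NNPair`, `NearPair`.  The proof is coordinates: `dist² = a² (X² + XY + Y²) + (Δz)²` with `(X, Y)` the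
in-plane offset in the triangular basis (integral on a layer, in the coset `σ w + Λ` between adjacent
layers), the integer quadratic form `P² + PQ + Q²` (resp. `P² + PQ + Q² + σ (P + Q)`) classified near
its minimum by a finite enumeration, and the exact rational margins of the box `a ∈ [47/50, 1]`,
`h ∈ [39a/50, 17a/20]`. -/

namespace StubSites

variable (a : ℝ) (s : ℤ → ℤ) (z : ℤ → ℝ)

/-- First coordinate of the site `pos a s z x`. [folklore] -/
theorem pos_apply_zero (x : Idx) :
    pos a s z x 0 = a * ((x.2.1 : ℝ) + (x.2.2 : ℝ) / 2 + (haggLabel s x.1 : ℝ) / 2) := by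
  simp [pos, triangularVec₁, triangularVec₂, barlowOffset, layerNormal]; ring

/-- Second coordinate of the site `pos a s z x`. [folklore] -/
theorem pos_apply_one (x : Idx) :
    pos a s z x 1 = a * √3 / 2 * ((x.2.2 : ℝ) + (haggLabel s x.1 : ℝ) / 3) := by
  simp [pos, triangularVec₁, triangularVec₂, barlowOffset, layerNormal]; ring

/-- Third coordinate of the site `pos a s z x`: layer `m` lies at height `z m`. [folklore] -/
theorem pos_apply_two (x : Idx) : pos a s z x 2 = z x.1 := by
  simp [pos, triangularVec₁, triangularVec₂, barlowOffset, layerNormal]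

/-- Squared distance of two sites in coordinates: the in-plane triangular form plus the height
difference squared. [folklore] -/
theorem dist_pos_sq (x y : Idx) :
    dist (pos a s z x) (pos a s z y) ^ 2 =
      a ^ 2 * (((y.2.1 : ℝ) - x.2.1 + ((y.2.2 : ℝ) - x.2.2) / 2 +
          ((haggLabel s y.1 : ℝ) - haggLabel s x.1) / 2) ^ 2 +
        3 / 4 * ((y.2.2 : ℝ) - x.2.2 + ((haggLabel s y.1 : ℝ) - haggLabel s x.1) / 3) ^ 2) +
      (z y.1 - z x.1) ^ 2 := by
  have h3 : (√3 : ℝ) ^ 2 = 3 := Real.sq_sqrt (by norm_num)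
  rw [EuclideanSpace.dist_sq_eq, Fin.sum_univ_three, Real.dist_eq, Real.dist_eq, Real.dist_eq,
    sq_abs, sq_abs, sq_abs, pos_apply_zero, pos_apply_zero, pos_apply_one, pos_apply_one,
    pos_apply_two, pos_apply_two]
  linear_combination
    (a ^ 2 / 4 * ((y.2.2 : ℝ) - x.2.2 + ((haggLabel s y.1 : ℝ) - haggLabel s x.1) / 3) ^ 2) * h3

/-- Same layer: `dist² = a² (P² + PQ + Q²)` with `(P, Q)` the index offset. [folklore] -/
theorem dist_pos_sq_of_fst_eq {x y : Idx} (h : y.1 = x.1) :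
    dist (pos a s z x) (pos a s z y) ^ 2 =
      a ^ 2 * ((y.2.1 - x.2.1) ^ 2 + (y.2.1 - x.2.1) * (y.2.2 - x.2.2) + (y.2.2 - x.2.2) ^ 2 : ℤ) := by
  rw [dist_pos_sq, h]; push_cast; ring

/-- Adjacent layers `m, m + 1` with letter `σ = s m`: `dist² = a² (G + 1/3) + h_m²` with
`G = P² + PQ + Q² + σ (P + Q)`. [folklore] -/
theorem dist_pos_sq_of_fst_eq_succ (hs : IsHaggSeq s) {x y : Idx} (h : y.1 = x.1 + 1) :
    dist (pos a s z x) (pos a s z y) ^ 2 =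
      a ^ 2 * (((y.2.1 - x.2.1) ^ 2 + (y.2.1 - x.2.1) * (y.2.2 - x.2.2) + (y.2.2 - x.2.2) ^ 2 +
        s x.1 * ((y.2.1 - x.2.1) + (y.2.2 - x.2.2)) : ℤ) + 1 / 3) + (z (x.1 + 1) - z x.1) ^ 2 := by
  have hσ : ((s x.1 : ℤ) : ℝ) ^ 2 = 1 := by rcases hs x.1 with h1 | h1 <;> simp [h1]
  rw [dist_pos_sq, h, haggLabel_succ]; push_cast
  linear_combination (a ^ 2 / 3) * hσ

/-- The height difference bounds the distance from below. [folklore] -/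
theorem sq_sub_le_dist_pos_sq (x y : Idx) :
    (z y.1 - z x.1) ^ 2 ≤ dist (pos a s z x) (pos a s z y) ^ 2 := by
  rw [dist_pos_sq]; exact le_add_of_nonneg_left (by positivity)

/-- Heights increase by at least `39a/50` per layer on the box. [folklore] -/
theorem mul_le_height_sub (hz : HeightBox a z) (m : ℤ) (k : ℕ) :
    (k : ℝ) * (39 / 50 * a) ≤ z (m + k) - z m := by
  induction k with
  | zero => simp
  | succ k ih =>
    have := (hz (m + k)).1
    push_cast
    rw [show m + ((k : ℤ) + 1) = m + k + 1 by ring]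
    linarith

/-- Layers two or more apart: `dist² ≥ (39a/25)²`. [folklore] -/
theorem sq_le_dist_pos_sq_of_two_le (ha : 0 ≤ a) (hz : HeightBox a z) {x y : Idx}
    (h : x.1 + 2 ≤ y.1) : (39 / 25 * a) ^ 2 ≤ dist (pos a s z x) (pos a s z y) ^ 2 := by
  obtain ⟨k, hk⟩ : ∃ k : ℕ, y.1 = x.1 + k := ⟨(y.1 - x.1).toNat, by omega⟩
  have hk2 : (2 : ℝ) ≤ k := by exact_mod_cast (show 2 ≤ k by omega)
  have h1 := mul_le_height_sub a z hz x.1 k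
  rw [← hk] at h1
  have h2 : 39 / 25 * a ≤ z y.1 - z x.1 := by nlinarith
  exact (pow_le_pow_left₀ (by positivity) h2 2).trans (sq_sub_le_dist_pos_sq a s z x y)

/-! ### The integer quadratic forms near their minima -/

/-- `P² + PQ + Q² ≤ 2` off the origin forces one of the six unit offsets. [folklore] -/
theorem inPlaneNN_of_le_two {P Q : ℤ} (h : P ^ 2 + P * Q + Q ^ 2 ≤ 2) (h0 : (P, Q) ≠ (0, 0)) :
    InPlaneNN (P, Q) := by
  have hP : P ≤ 1 ∧ -1 ≤ P := by constructor <;> nlinarith [sq_nonneg (2 * Q + P)]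
  have hQ : Q ≤ 1 ∧ -1 ≤ Q := by constructor <;> nlinarith [sq_nonneg (2 * P + Q)]
  obtain ⟨hP1, hP2⟩ := hP
  obtain ⟨hQ1, hQ2⟩ := hQ
  unfold InPlaneNN
  interval_cases P <;> interval_cases Q <;> simp_all

/-- The six unit offsets have `P² + PQ + Q² = 1`. [folklore] -/
theorem form_eq_one_of_inPlaneNN {P Q : ℤ} (h : InPlaneNN (P, Q)) : P ^ 2 + P * Q + Q ^ 2 = 1 := by
  rcases h with h | h | h | h | h | h <;> simp only [Prod.mk.injEq] at h <;> obtain ⟨rfl, rfl⟩ := h <;>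
    norm_num

/-- The interlayer form `G = P² + PQ + Q² + σ (P + Q)` (`σ = ±1`) is nonnegative. [folklore] -/
theorem form_nonneg {σ : ℤ} (hσ : σ = 1 ∨ σ = -1) (P Q : ℤ) :
    0 ≤ P ^ 2 + P * Q + Q ^ 2 + σ * (P + Q) := by
  rcases hσ with rfl | rfl <;>
    nlinarith [sq_nonneg (2 * Q + P + 1), sq_nonneg (2 * Q + P - 1), sq_nonneg (3 * P + 1),
      sq_nonneg (3 * P - 1)]

/-- `G ≤ 1` forces `G = 0` and an `UpNN` offset, or `G = 1` and an `UpDiag` offset. [folklore] -/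
theorem upNN_or_upDiag_of_le_one {σ : ℤ} (hσ : σ = 1 ∨ σ = -1) {P Q : ℤ}
    (h : P ^ 2 + P * Q + Q ^ 2 + σ * (P + Q) ≤ 1) :
    (P ^ 2 + P * Q + Q ^ 2 + σ * (P + Q) = 0 ∧ UpNN σ (P, Q)) ∨
      (P ^ 2 + P * Q + Q ^ 2 + σ * (P + Q) = 1 ∧ UpDiag σ (P, Q)) := by
  unfold UpNN UpDiag
  rcases hσ with rfl | rfl
  all_goals
    have hP : P ≤ 1 ∧ -1 ≤ P := by
      constructor <;> nlinarith [sq_nonneg (2 * Q + P + 1), sq_nonneg (2 * Q + P - 1)]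
    have hQ : Q ≤ 1 ∧ -1 ≤ Q := by
      constructor <;> nlinarith [sq_nonneg (2 * P + Q + 1), sq_nonneg (2 * P + Q - 1)]
    obtain ⟨hP1, hP2⟩ := hP
    obtain ⟨hQ1, hQ2⟩ := hQ
    interval_cases P <;> interval_cases Q <;> simp_all

/-- `UpNN` offsets have `G = 0`. [folklore] -/
theorem form_eq_zero_of_upNN {σ : ℤ} (hσ : σ = 1 ∨ σ = -1) {P Q : ℤ} (h : UpNN σ (P, Q)) :
    P ^ 2 + P * Q + Q ^ 2 + σ * (P + Q) = 0 := by
  rcases h with h | h | h <;> simp only [Prod.mk.injEq] at h <;> obtain ⟨rfl, rfl⟩ := h <;>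
    rcases hσ with rfl | rfl <;> norm_num

/-- `UpDiag` offsets have `G = 1`. [folklore] -/
theorem form_eq_one_of_upDiag {σ : ℤ} (hσ : σ = 1 ∨ σ = -1) {P Q : ℤ} (h : UpDiag σ (P, Q)) :
    P ^ 2 + P * Q + Q ^ 2 + σ * (P + Q) = 1 := by
  rcases h with h | h | h <;> simp only [Prod.mk.injEq] at h <;> obtain ⟨rfl, rfl⟩ := h <;>
    rcases hσ with rfl | rfl <;> norm_num

/-! ### The metric analysis per layer offset -/

variable {a s z}

/-- Same layer: separation, and the shells are the six unit offsets. [folklore] -/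
theorem same_facts (ha : 47 / 50 ≤ a) (ha1 : a ≤ 1) {x y : Idx} (h : y.1 = x.1) :
    (x ≠ y → 81 / 100 ≤ dist (pos a s z x) (pos a s z y) ^ 2 ∧
      (dist (pos a s z x) (pos a s z y) ^ 2 ≤ 841 / 400 →
        InPlaneNN (y.2.1 - x.2.1, y.2.2 - x.2.2) ∧
          dist (pos a s z x) (pos a s z y) ^ 2 ≤ 121 / 100)) ∧
    (InPlaneNN (y.2.1 - x.2.1, y.2.2 - x.2.2) →
      x ≠ y ∧ dist (pos a s z x) (pos a s z y) ^ 2 ≤ 121 / 100) := by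
  have key := dist_pos_sq_of_fst_eq a s z h
  have hne : x ≠ y ↔ (y.2.1 - x.2.1, y.2.2 - x.2.2) ≠ (0, 0) := by
    obtain ⟨m, i, j⟩ := x
    obtain ⟨m', i', j'⟩ := y
    simp only at h
    simp only [ne_eq, Prod.mk.injEq, not_and]
    omega
  have h1 := fun h0 => one_le_sq_add_mul_add_sq (p := y.2.1 - x.2.1) (q := y.2.2 - x.2.2) h0
  have h2 := fun hle h0 => inPlaneNN_of_le_two (P := y.2.1 - x.2.1) (Q := y.2.2 - x.2.2) hle h0
  have h4 := fun hnn => form_eq_one_of_inPlaneNN (P := y.2.1 - x.2.1) (Q := y.2.2 - x.2.2) hnn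
  rw [hne]
  generalize y.2.1 - x.2.1 = P at *
  generalize y.2.2 - x.2.2 = Q at *
  have ha2 : 2209 / 2500 ≤ a ^ 2 := by nlinarith
  refine ⟨fun h0 => ?_, fun hnn => ⟨?_, ?_⟩⟩
  · have h1' : (1 : ℝ) ≤ (P ^ 2 + P * Q + Q ^ 2 : ℤ) := by exact_mod_cast h1 h0
    refine ⟨by rw [key]; nlinarith, fun hle => ?_⟩
    have h3 : ((P ^ 2 + P * Q + Q ^ 2 : ℤ) : ℝ) < 3 := by
      by_contra hc
      rw [key] at hle
      nlinarith
    have h3' : P ^ 2 + P * Q + Q ^ 2 < 3 := by exact_mod_cast h3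
    have hnn := h2 (by omega) h0
    refine ⟨hnn, ?_⟩
    rw [key, h4 hnn]; push_cast; nlinarith
  · intro h0
    rw [h0] at hnn
    simp [InPlaneNN] at hnn
  · rw [key, h4 hnn]; push_cast; nlinarith

/-- Adjacent layers (oriented, `y` above `x`): separation, and the shells are `UpNN` / `UpDiag`.
[folklore] -/
theorem succ_facts (ha : 47 / 50 ≤ a) (ha1 : a ≤ 1) (hs : IsHaggSeq s) (hz : HeightBox a z)
    {x y : Idx} (h : y.1 = x.1 + 1) :
    81 / 100 ≤ dist (pos a s z x) (pos a s z y) ^ 2 ∧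
    (dist (pos a s z x) (pos a s z y) ^ 2 ≤ 841 / 400 →
      (UpNN (s x.1) (y.2.1 - x.2.1, y.2.2 - x.2.2) ∧
          dist (pos a s z x) (pos a s z y) ^ 2 ≤ 121 / 100) ∨
        (UpDiag (s x.1) (y.2.1 - x.2.1, y.2.2 - x.2.2) ∧
          121 / 100 < dist (pos a s z x) (pos a s z y) ^ 2)) ∧
    (UpNN (s x.1) (y.2.1 - x.2.1, y.2.2 - x.2.2) →
      dist (pos a s z x) (pos a s z y) ^ 2 ≤ 121 / 100) ∧
    (UpDiag (s x.1) (y.2.1 - x.2.1, y.2.2 - x.2.2) →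
      dist (pos a s z x) (pos a s z y) ^ 2 ≤ 841 / 400) := by
  have hσ : s x.1 = 1 ∨ s x.1 = -1 := hs x.1
  have key := dist_pos_sq_of_fst_eq_succ a s z hs h
  have hG0 := form_nonneg hσ (y.2.1 - x.2.1) (y.2.2 - x.2.2)
  have hcl := fun hle => upNN_or_upDiag_of_le_one hσ (P := y.2.1 - x.2.1) (Q := y.2.2 - x.2.2) hle
  have hz0 := fun hnn => form_eq_zero_of_upNN hσ (P := y.2.1 - x.2.1) (Q := y.2.2 - x.2.2) hnn
  have hz1 := fun hd => form_eq_one_of_upDiag hσ (P := y.2.1 - x.2.1) (Q := y.2.2 - x.2.2) hd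
  generalize y.2.1 - x.2.1 = P at *
  generalize y.2.2 - x.2.2 = Q at *
  generalize s x.1 = σ at *
  obtain ⟨hg1, hg2⟩ := hz x.1
  have ha2 : 2209 / 2500 ≤ a ^ 2 := by nlinarith
  have hh1 : 1521 / 2500 * a ^ 2 ≤ (z (x.1 + 1) - z x.1) ^ 2 := by nlinarith
  have hh2 : (z (x.1 + 1) - z x.1) ^ 2 ≤ 289 / 400 * a ^ 2 := by nlinarith
  have hG0' : (0 : ℝ) ≤ (P ^ 2 + P * Q + Q ^ 2 + σ * (P + Q) : ℤ) := by exact_mod_cast hG0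
  refine ⟨by rw [key]; nlinarith, fun hle => ?_, fun hnn => ?_, fun hd => ?_⟩
  · have hG2 : ((P ^ 2 + P * Q + Q ^ 2 + σ * (P + Q) : ℤ) : ℝ) < 2 := by
      by_contra hc
      rw [key] at hle
      nlinarith
    have hG2' : P ^ 2 + P * Q + Q ^ 2 + σ * (P + Q) < 2 := by exact_mod_cast hG2
    rcases hcl (by omega) with ⟨hG, hnn⟩ | ⟨hG, hd⟩
    · left
      refine ⟨hnn, ?_⟩
      rw [key, hG]; push_cast; nlinarith
    · right
      refine ⟨hd, ?_⟩
      rw [key, hG]; push_cast; nlinarith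
  · rw [key, hz0 hnn]; push_cast; nlinarith
  · rw [key, hz1 hd]; push_cast; nlinarith

/-- The classification of a pair of distinct sites by squared distance. [folklore] -/
theorem classify (ha : 47 / 50 ≤ a) (ha1 : a ≤ 1) (hs : IsHaggSeq s) (hz : HeightBox a z)
    {x y : Idx} (hxy : x ≠ y) :
    81 / 100 ≤ dist (pos a s z x) (pos a s z y) ^ 2 ∧
    (dist (pos a s z x) (pos a s z y) ^ 2 ≤ 841 / 400 →
      (NNPair s x y ∧ dist (pos a s z x) (pos a s z y) ^ 2 ≤ 121 / 100) ∨
      (DiagPair s x y ∧ 121 / 100 < dist (pos a s z x) (pos a s z y) ^ 2)) := by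
  have ha0 : 0 ≤ a := by linarith
  have hfar : (841 / 400 : ℝ) < (39 / 25 * a) ^ 2 := by nlinarith
  rcases lt_trichotomy y.1 x.1 with hlt | heq | hgt
  · rcases eq_or_lt_of_le (show y.1 + 1 ≤ x.1 by omega) with h1 | h1
    · obtain ⟨h0, hcl, -, -⟩ := succ_facts ha ha1 hs hz (x := y) (y := x) h1.symm
      rw [dist_comm] at h0 hcl
      exact ⟨h0, fun hle => (hcl hle).imp (fun h => ⟨Or.inr (Or.inr ⟨h1.symm, h.1⟩), h.2⟩)
        (fun h => ⟨Or.inr ⟨h1.symm, h.1⟩, h.2⟩)⟩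
    · have h2 := sq_le_dist_pos_sq_of_two_le a s z ha0 hz (x := y) (y := x) (by omega)
      rw [dist_comm] at h2
      exact ⟨by linarith, fun hle => absurd hle (by linarith)⟩
  · obtain ⟨h0, -⟩ := same_facts (s := s) (z := z) ha ha1 heq
    obtain ⟨h0, hcl⟩ := h0 hxy
    exact ⟨h0, fun hle => Or.inl ⟨Or.inl ⟨heq, (hcl hle).1⟩, (hcl hle).2⟩⟩
  · rcases eq_or_lt_of_le (show x.1 + 1 ≤ y.1 by omega) with h1 | h1
    · obtain ⟨h0, hcl, -, -⟩ := succ_facts ha ha1 hs hz h1.symm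
      exact ⟨h0, fun hle => (hcl hle).imp (fun h => ⟨Or.inr (Or.inl ⟨h1.symm, h.1⟩), h.2⟩)
        (fun h => ⟨Or.inl ⟨h1.symm, h.1⟩, h.2⟩)⟩
    · have h2 := sq_le_dist_pos_sq_of_two_le a s z ha0 hz (x := x) (y := y) (by omega)
      exact ⟨by linarith, fun hle => absurd hle (by linarith)⟩

/-- Nearest-neighbour pairs are distinct and within `11/10`. [folklore] -/
theorem nn_fwd (ha : 47 / 50 ≤ a) (ha1 : a ≤ 1) (hs : IsHaggSeq s) (hz : HeightBox a z)
    {x y : Idx} (hnn : NNPair s x y) :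
    x ≠ y ∧ dist (pos a s z x) (pos a s z y) ^ 2 ≤ 121 / 100 := by
  rcases hnn with ⟨h, hnn⟩ | ⟨h, hnn⟩ | ⟨h, hnn⟩
  · exact (same_facts ha ha1 h).2 hnn
  · exact ⟨fun heq => by rw [heq] at h; omega, (succ_facts ha ha1 hs hz h).2.2.1 hnn⟩
  · refine ⟨fun heq => by rw [heq] at h; omega, ?_⟩
    rw [dist_comm]
    exact (succ_facts ha ha1 hs hz h).2.2.1 hnn

/-- Octahedron-diagonal pairs are distinct and within `29/20`. [folklore] -/
theorem diag_fwd (ha : 47 / 50 ≤ a) (ha1 : a ≤ 1) (hs : IsHaggSeq s) (hz : HeightBox a z)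
    {x y : Idx} (hd : DiagPair s x y) :
    x ≠ y ∧ dist (pos a s z x) (pos a s z y) ^ 2 ≤ 841 / 400 := by
  rcases hd with ⟨h, hd⟩ | ⟨h, hd⟩
  · exact ⟨fun heq => by rw [heq] at h; omega, (succ_facts ha ha1 hs hz h).2.2.2 hd⟩
  · refine ⟨fun heq => by rw [heq] at h; omega, ?_⟩
    rw [dist_comm]
    exact (succ_facts ha ha1 hs hz h).2.2.2 hd

/-- `r ≤ dist ↔ r² ≤ dist²` and `dist ≤ r ↔ dist² ≤ r²` for `r ≥ 0`. [folklore] -/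
theorem le_dist_iff_sq {p q : EuclideanSpace ℝ (Fin 3)} {r : ℝ} (hr : 0 ≤ r) :
    (r ≤ dist p q ↔ r ^ 2 ≤ dist p q ^ 2) ∧ (dist p q ≤ r ↔ dist p q ^ 2 ≤ r ^ 2) :=
  ⟨(pow_le_pow_iff_left₀ hr dist_nonneg two_ne_zero).symm,
    (pow_le_pow_iff_left₀ dist_nonneg hr two_ne_zero).symm⟩

end StubSites

open StubSites in
/-- Registered stub `stub_sites` of the line `birth`: on the box, `pos` is a bijection
`Idx ≃ Sites a s z`, distinct sites are `9/10`-separated, and the metric shells `dist ≤ 11/10`,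
`dist ≤ 29/20` are exactly the combinatorial shells `NNPair`, `NearPair`. [folklore] -/
theorem stub_sites : ∀ (a : ℝ) (s : ℤ → ℤ) (z : ℤ → ℝ), 47 / 50 ≤ a → a ≤ 1 → IsHaggSeq s →
    HeightBox a z → SitesFacts a s z := by
  intro a s z ha ha1 hs hz
  have sep : ∀ x y : Idx, x ≠ y → 9 / 10 ≤ dist (pos a s z x) (pos a s z y) := fun x y hxy =>
    ((le_dist_iff_sq (by norm_num)).1).2 (by norm_num; exact (classify ha ha1 hs hz hxy).1)
  refine ⟨fun x y hxy => ?_, ?_, sep, fun x y => ⟨fun ⟨hxy, hle⟩ => ?_, fun hnn => ?_⟩,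
    fun x y => ⟨fun ⟨hxy, hle⟩ => ?_, fun hnear => ?_⟩⟩
  · by_contra hne
    have := sep x y hne
    rw [hxy, dist_self] at this
    norm_num at this
  · ext p
    constructor
    · rintro ⟨⟨m, i, j⟩, rfl⟩
      exact ⟨m, i, j, rfl⟩
    · rintro ⟨m, i, j, rfl⟩
      exact ⟨(m, i, j), rfl⟩
  · have hle' : dist (pos a s z x) (pos a s z y) ^ 2 ≤ 121 / 100 := by
      have := ((le_dist_iff_sq (by norm_num)).2).1 hle; norm_num at this; exact this
    rcases (classify ha ha1 hs hz hxy).2 (by linarith) with ⟨h, -⟩ | ⟨-, h⟩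
    · exact h
    · exact absurd hle' (not_le.2 h)
  · obtain ⟨hxy, hle⟩ := nn_fwd ha ha1 hs hz hnn
    exact ⟨hxy, ((le_dist_iff_sq (by norm_num)).2).2 (by norm_num; linarith)⟩
  · have hle' : dist (pos a s z x) (pos a s z y) ^ 2 ≤ 841 / 400 := by
      have := ((le_dist_iff_sq (by norm_num)).2).1 hle; norm_num at this; exact this
    rcases (classify ha ha1 hs hz hxy).2 hle' with ⟨h, -⟩ | ⟨h, -⟩
    · exact Or.inl h
    · exact Or.inr h
  · rcases hnear with hnn | hd
    · obtain ⟨hxy, hle⟩ := nn_fwd ha ha1 hs hz hnn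
      exact ⟨hxy, ((le_dist_iff_sq (by norm_num)).2).2 (by norm_num; linarith)⟩
    · obtain ⟨hxy, hle⟩ := diag_fwd ha ha1 hs hz hd
      exact ⟨hxy, ((le_dist_iff_sq (by norm_num)).2).2 (by norm_num; linarith)⟩

end Summit.AtomisticToContinuum.Crystallization.Theorems.UniformPolytypeStabilityCells
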